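import Literature.Geometry.Riemannian.ChangGurskyYangWeylBudget
import Literature.Geometry.Riemannian.SelfDualMetric
import Literature.Geometry.Lorentzian.ChartWeyl
import Literature.Geometry.Lorentzian.ConformalChangeFour
import Literature.Geometry.Lorentzian.CurvatureNaturality
import Literature.Geometry.Lorentzian.ConformalVolume
import HarnessLib

/-!
# Conformal covariance of the chiral Weyl tensor `W⁺` and conformal invariance of `∫|W⁺|² dμ`
# in dimension four

Topic `Geometry/Riemannian` (everything proved; no definition, no statement of `Prop` type). The chiral
refinement of `Lorentzian/WeylConformal.lean` (`|W_{ψ²g}|² = ψ⁻⁴|W_g|²`, `∫|W|² dμ` conformally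
invariant): in the frame-wise vocabulary of the oriented reduction
`gursky_einstein_homotopySphere_four_of_oriented` (`GurskyEinsteinGapProofs.lean`) — `W⁺` read as
the traceless part `A − (tr A/3)1` of Hamilton's self-dual block `A = (R(φᵢ, φⱼ))`
(`CurvatureDecomposition.lean`) in positively oriented orthonormal frames — we prove that
`g ↦ ψ² g` rescales `A − (tr A/3)1` by `ψ⁻²` (frames `e ↦ e/ψ`) and hence leaves `∫|W⁺|² dμ`
invariant: "the `L²` norm of `W⁺` is conformally invariant" (Gursky–LeBrun 1999, §3, proof of
Theorem 1), the input that makes the modified Yamabe argument of Lemma 4 scale-free.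

* `WeylBlocks.blockArr_sdIdx_kulkarniNomizu_frameDelta`, `…_asdIdx_…` — the algebra: for a
  symmetric `4 × 4` array `b`, Hamilton's `A`- and `C`-blocks of the Kulkarni–Nomizu array
  `b ⊙ δ` (`kulkarniNomizu`, `ChangGurskyYangProofs.lean`) are the SCALAR matrices `(tr b)·1`
  (the traceless part `b₀ ⊙ δ` is of traceless-Ricci type and lives in the off-diagonal block `B`;
  Besse 1987, 1.114, 1.126); `WeylBlocks.blockArr_smul_sub` (linearity of the blocks in the array).
* `OpensChart.blockA_traceFree_conformal`, `OpensChart.blockC_traceFree_conformal` — for metrics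
  `g`, `g' = c·g` on `U : Opens E` with representatives `G`, `c·G`, a `g_x`-orthonormal `4`-frame
  `e` and `c(x) = a²`: `A'(e/a) − (tr A'/3)1 = a⁻²(A(e) − (tr A/3)1)` and the same for `C` — from
  Besse 1.159 (b) in coordinates (`MetricCoord.IsMetricOn.apply_riemAt_conformal`,
  `ConformalChangeFour.lean`: `Rm'(e/a) = a⁻²(Rm(e) − B ⊙ δ)`) and the algebra above.
* `PseudoRiemannianMetric.blockA_comap`, `.blockC_comap` — naturality of Hamilton's blocks under
  local diffeomorphisms (O'Neill 1983, Ch. 3, Prop. 3.59, through `riemann_comap_apply`).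
* `blockA_traceFree_conformal_sq` — **the law on a manifold** modelled on a `4`-dimensional `E`:
  for `g' = ψ² g` and a `g_x`-orthonormal frame `e`, `A'₀(e/ψ) = ψ(x)⁻² A₀(e)` (pull back along
  the inverse chart, as in `WeylConformal.lean` / `ConformalChangeFour.lean`).
* `det_frameOfFin_smul`, `isPosFrame_smul_iff` — rescaling a frame by `c > 0` multiplies its
  determinant by `c⁴` and preserves its orientation character (`SmoothOrientation.IsPosFrame`).
* `chiralWeylEnergy_conformal_sq_four` — **conformal invariance of `∫|W⁺|² dμ` on a compact oriented
  `4`-manifold**: if `w₊` is a version of `|W⁺_g|²` (`= ¼‖A − (tr A/3)1‖²_F` in a positive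
  orthonormal frame at each point) then `ψ⁻⁴w₊` is a version of `|W⁺_{ψ²g}|²` and
  `∫ ψ⁻⁴ w₊ dμ_{ψ²g} = ∫ w₊ dμ_g` (`dμ_{ψ²g} = ψ⁴ dμ_g`,
  `riemannianMeasure_eq_withDensity_of_conformal_sq_four`, `ConformalVolume.lean`).

## References

* A. L. Besse, *Einstein manifolds*, Springer 1987, 1.114, 1.126, Thm. 1.159. [Besse1987]
* M. J. Gursky, C. LeBrun, Ann. Global Anal. Geom. 17 (1999) 315–328 (arXiv:math/9807055), §3,
  proof of Theorem 1. [GurskyLebrun1999]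
* R. S. Hamilton, Comm. Anal. Geom. 5 (1997), §1.2 (blocks `A, B, C`). [Hamilton1997]
* B. O'Neill, *Semi-Riemannian geometry*, Academic Press 1983, Ch. 3, Prop. 3.59. [ONeill1983]
-/

noncomputable section

set_option maxSynthPendingDepth 3

open Bundle Set Function Filter ContinuousLinearMap TopologicalSpace Manifold Module Finset MeasureTheory
open scoped Manifold ContDiff Topology Matrix

namespace Literature.Geometry.Riemannian

open Literature.Geometry.Lorentzian Literature.Geometry.Lorentzian.PseudoRiemannianMetric
open Literature.Topology.FourManifolds (SmoothOrientation)

namespace WeylBlocks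

/-- **The `A`-block of a Kulkarni–Nomizu product `b ⊙ δ` is scalar**: for a symmetric `4 × 4`
array `b`, Hamilton's self-dual block of the array `(b ⊙ δ)_{ijkl} = b_{il}δ_{jk} + b_{jk}δ_{il} −
b_{ik}δ_{jl} − b_{jl}δ_{ik}` is `(tr b)·1` (the traceless part `b₀ ⊙ δ` maps `Λ⁺` to `Λ⁻`, i.e.
lives in the `B`-block; Besse 1987, 1.114/1.126). [cite: Besse1987, 1.126] -/
theorem blockArr_sdIdx_kulkarniNomizu_frameDelta (b : Fin 4 → Fin 4 → ℝ) (hb : ∀ i j, b i j = b j i)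
    (i j : Fin 3) :
    blockArr sdIdx sdIdx (kulkarniNomizu b frameDelta) i j = (∑ a, b a a) * frameDelta i j := by
  have hd4 : ∀ a c : Fin 4, a ≠ c → frameDelta a c = 0 := fun a c h ↦ frameDelta_of_ne h
  have hd3 : ∀ a c : Fin 3, a ≠ c → frameDelta a c = 0 := fun a c h ↦ frameDelta_of_ne h
  fin_cases i <;> fin_cases j <;>
    simp [blockArr, kulkarniNomizu, Fin.sum_univ_two, Fin.sum_univ_four, frameDelta_self, hd4, hd3,
      hb 1 0, hb 2 0, hb 3 0, hb 2 1, hb 3 1, hb 3 2] <;> ring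

/-- Dually, the `C`-block of `b ⊙ δ` is `(tr b)·1`. [cite: Besse1987, 1.126] -/
theorem blockArr_asdIdx_kulkarniNomizu_frameDelta (b : Fin 4 → Fin 4 → ℝ) (hb : ∀ i j, b i j = b j i)
    (i j : Fin 3) :
    blockArr asdIdx asdIdx (kulkarniNomizu b frameDelta) i j = (∑ a, b a a) * frameDelta i j := by
  have hd4 : ∀ a c : Fin 4, a ≠ c → frameDelta a c = 0 := fun a c h ↦ frameDelta_of_ne h
  have hd3 : ∀ a c : Fin 3, a ≠ c → frameDelta a c = 0 := fun a c h ↦ frameDelta_of_ne h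
  fin_cases i <;> fin_cases j <;>
    simp [blockArr, kulkarniNomizu, Fin.sum_univ_two, Fin.sum_univ_four, frameDelta_self, hd4, hd3,
      hb 1 0, hb 2 0, hb 3 0, hb 2 1, hb 3 1, hb 3 2] <;> ring

/-- `blockArr` is linear in the array: scaling and subtraction. [folklore] -/
theorem blockArr_smul_sub (P Q : Fin 3 → Fin 2 → Fin 4 × Fin 4) (α : ℝ)
    (R K : Fin 4 → Fin 4 → Fin 4 → Fin 4 → ℝ) (i j : Fin 3) :
    blockArr P Q (fun a b c d ↦ α * (R a b c d - K a b c d)) i j =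
      α * (blockArr P Q R i j - blockArr P Q K i j) := by
  simp only [blockArr, Finset.mul_sum, ← Finset.sum_sub_distrib, mul_sub]

end WeylBlocks

/-! ### The chart law for the traceless blocks -/

namespace OpensChart

open Literature.Geometry.Lorentzian.OpensChart WeylBlocks

variable {E : Type*} [NormedAddCommGroup E] [NormedSpace ℝ E] [FiniteDimensional ℝ E]
  [CompleteSpace E] {U : Opens E}
  {g : PseudoRiemannianMetric 𝓘(ℝ, E) ∞ E (TangentSpace 𝓘(ℝ, E) : U → Type _)}
  {G : E → E →L[ℝ] E →L[ℝ] ℝ} (hG : ∀ y : U, g.val y = G y)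

include hG

set_option maxHeartbeats 800000 in
/-- **Conformal covariance of Hamilton's self-dual block, traceless part**: for `g' = c g` on
`U : Opens E` (`c` smooth, nowhere zero, `c(x) = a²`), a `g_x`-orthonormal `4`-frame `e` and the
rescaled `g'_x`-orthonormal frame `e/a`,
`A'(e/a) − (tr A'(e/a)/3)1 = a⁻² (A(e) − (tr A(e)/3)1)` — the frame form of the conformal covariance
of `W⁺` (Besse 1987, 1.159 with 1.126): `Rm'(e/a) = a⁻²(Rm(e) − B ⊙ δ)` by Besse 1.159 (b)
(`MetricCoord.IsMetricOn.apply_riemAt_conformal`), and the `A`-block of `B ⊙ δ` is scalar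
(`blockArr_sdIdx_kulkarniNomizu_frameDelta`). [cite: Besse1987, Thm. 1.159] -/
theorem blockA_traceFree_conformal [g.HasLeviCivita]
    {g' : PseudoRiemannianMetric 𝓘(ℝ, E) ∞ E (TangentSpace 𝓘(ℝ, E) : U → Type _)} [g'.HasLeviCivita]
    {c : E → ℝ} (hG' : ∀ y : U, g'.val y = (fun y ↦ c y • G y) y)
    (hc : ContDiffOn ℝ ∞ c (U : Set E)) (hc0 : ∀ y ∈ (U : Set E), c y ≠ 0)
    (x : U) {a : ℝ} (ha : a ≠ 0) (hax : c x = a ^ 2)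
    {e : Fin 4 → E} (he : g.IsOrthonormalFrame x e) :
    g'.blockA g'.leviCivita x (fun i ↦ a⁻¹ • e i) -
        ((g'.blockA g'.leviCivita x (fun i ↦ a⁻¹ • e i)).trace / 3) • (1 : Matrix (Fin 3) (Fin 3) ℝ) =
      (a ^ 2)⁻¹ • (g.blockA g.leviCivita x e -
        ((g.blockA g.leviCivita x e).trace / 3) • (1 : Matrix (Fin 3) (Fin 3) ℝ)) := by
  have hmet : MetricCoord.IsMetricOn G (U : Set E) := isMetricOn_repr hG
  have hs := hmet.symm x x.2
  -- the symmetric form `B` of Besse 1.159 (b), read on the frame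
  set B : Fin 4 → Fin 4 → ℝ := fun p q ↦
    MetricCoord.confHess G c x (e p) (e q) - MetricCoord.confForm c x (e p) * MetricCoord.confForm c x (e q)
      + 1 / 2 * MetricCoord.confForm c x (MetricCoord.confVec G c x) * G x (e p) (e q) with hB
  have hBs : ∀ p q, B p q = B q p := by
    intro p q
    simp only [hB, MetricCoord.confHess_apply, hmet.fderiv_confForm_comm hc hc0 x.2 (e p) (e q),
      hmet.chrAt_comm x.2 (e p) (e q), hs (e p) (e q)]
    ring
  -- the frame arrays
  set R : Fin 4 → Fin 4 → Fin 4 → Fin 4 → ℝ :=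
    fun p q r s ↦ g.curvatureForm g.leviCivita x (e p) (e q) (e r) (e s) with hR
  have hδ : ∀ p q, G x (e p) (e q) = frameDelta p q := by
    intro p q
    rw [← hG x]
    by_cases hpq : p = q
    · subst hpq; rw [frameDelta_self]; exact he.1 p
    · rw [frameDelta_of_ne hpq]; exact he.2 p q hpq
  have hR' : ∀ p q r s, g'.curvatureForm g'.leviCivita x (a⁻¹ • e p) (a⁻¹ • e q) (a⁻¹ • e r)
      (a⁻¹ • e s) = (a ^ 2)⁻¹ * (R p q r s - kulkarniNomizu B frameDelta p q r s) := by
    intro p q r s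
    rw [curvatureForm_eq_apply_riemAt (G := fun y ↦ c y • G y) hG' x,
      MetricCoord.riemAt_smul_left, MetricCoord.riemAt_smul_right, map_smul, map_smul,
      MetricCoord.conformal_apply, hax]
    simp only [_root_.smul_apply, map_smul, smul_eq_mul]
    rw [hmet.apply_riemAt_conformal hc hc0 x.2, ← curvatureForm_eq_apply_riemAt hG x]
    simp only [hR, hB, kulkarniNomizu, hδ]
    field_simp
  -- the blocks
  have hA' : ∀ i j, g'.blockA g'.leviCivita x (fun i ↦ a⁻¹ • e i) i j =
      (a ^ 2)⁻¹ * (g.blockA g.leviCivita x e i j - (∑ p, B p p) * frameDelta i j) := by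
    intro i j
    rw [blockA_eq_blockArr, blockA_eq_blockArr]
    simp only [hR']
    rw [blockArr_smul_sub, blockArr_sdIdx_kulkarniNomizu_frameDelta B hBs]
  ext i j
  simp only [Matrix.sub_apply, Matrix.smul_apply, Matrix.one_apply, Matrix.trace, Matrix.diag_apply,
    smul_eq_mul, hA', Fin.sum_univ_three, frameDelta]
  by_cases hij : i = j
  · subst hij
    simp
    ring
  · simp [hij]

set_option maxHeartbeats 800000 in
/-- **Conformal covariance of Hamilton's anti-self-dual block, traceless part** (`W⁻`; the mirror
of `blockA_traceFree_conformal`, with `blockArr_asdIdx_kulkarniNomizu_frameDelta`).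
[cite: Besse1987, Thm. 1.159] -/
theorem blockC_traceFree_conformal [g.HasLeviCivita]
    {g' : PseudoRiemannianMetric 𝓘(ℝ, E) ∞ E (TangentSpace 𝓘(ℝ, E) : U → Type _)} [g'.HasLeviCivita]
    {c : E → ℝ} (hG' : ∀ y : U, g'.val y = (fun y ↦ c y • G y) y)
    (hc : ContDiffOn ℝ ∞ c (U : Set E)) (hc0 : ∀ y ∈ (U : Set E), c y ≠ 0)
    (x : U) {a : ℝ} (ha : a ≠ 0) (hax : c x = a ^ 2)
    {e : Fin 4 → E} (he : g.IsOrthonormalFrame x e) :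
    g'.blockC g'.leviCivita x (fun i ↦ a⁻¹ • e i) -
        ((g'.blockC g'.leviCivita x (fun i ↦ a⁻¹ • e i)).trace / 3) • (1 : Matrix (Fin 3) (Fin 3) ℝ) =
      (a ^ 2)⁻¹ • (g.blockC g.leviCivita x e -
        ((g.blockC g.leviCivita x e).trace / 3) • (1 : Matrix (Fin 3) (Fin 3) ℝ)) := by
  have hmet : MetricCoord.IsMetricOn G (U : Set E) := isMetricOn_repr hG
  have hs := hmet.symm x x.2
  set B : Fin 4 → Fin 4 → ℝ := fun p q ↦
    MetricCoord.confHess G c x (e p) (e q) - MetricCoord.confForm c x (e p) * MetricCoord.confForm c x (e q)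
      + 1 / 2 * MetricCoord.confForm c x (MetricCoord.confVec G c x) * G x (e p) (e q) with hB
  have hBs : ∀ p q, B p q = B q p := by
    intro p q
    simp only [hB, MetricCoord.confHess_apply, hmet.fderiv_confForm_comm hc hc0 x.2 (e p) (e q),
      hmet.chrAt_comm x.2 (e p) (e q), hs (e p) (e q)]
    ring
  set R : Fin 4 → Fin 4 → Fin 4 → Fin 4 → ℝ :=
    fun p q r s ↦ g.curvatureForm g.leviCivita x (e p) (e q) (e r) (e s) with hR
  have hδ : ∀ p q, G x (e p) (e q) = frameDelta p q := by
    intro p q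
    rw [← hG x]
    by_cases hpq : p = q
    · subst hpq; rw [frameDelta_self]; exact he.1 p
    · rw [frameDelta_of_ne hpq]; exact he.2 p q hpq
  have hR' : ∀ p q r s, g'.curvatureForm g'.leviCivita x (a⁻¹ • e p) (a⁻¹ • e q) (a⁻¹ • e r)
      (a⁻¹ • e s) = (a ^ 2)⁻¹ * (R p q r s - kulkarniNomizu B frameDelta p q r s) := by
    intro p q r s
    rw [curvatureForm_eq_apply_riemAt (G := fun y ↦ c y • G y) hG' x,
      MetricCoord.riemAt_smul_left, MetricCoord.riemAt_smul_right, map_smul, map_smul,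
      MetricCoord.conformal_apply, hax]
    simp only [_root_.smul_apply, map_smul, smul_eq_mul]
    rw [hmet.apply_riemAt_conformal hc hc0 x.2, ← curvatureForm_eq_apply_riemAt hG x]
    simp only [hR, hB, kulkarniNomizu, hδ]
    field_simp
  have hC' : ∀ i j, g'.blockC g'.leviCivita x (fun i ↦ a⁻¹ • e i) i j =
      (a ^ 2)⁻¹ * (g.blockC g.leviCivita x e i j - (∑ p, B p p) * frameDelta i j) := by
    intro i j
    rw [blockC_eq_blockArr, blockC_eq_blockArr]
    simp only [hR']
    rw [blockArr_smul_sub, blockArr_asdIdx_kulkarniNomizu_frameDelta B hBs]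
  ext i j
  simp only [Matrix.sub_apply, Matrix.smul_apply, Matrix.one_apply, Matrix.trace, Matrix.diag_apply,
    smul_eq_mul, hC', Fin.sum_univ_three, frameDelta]
  by_cases hij : i = j
  · subst hij
    simp
    ring
  · simp [hij]

end OpensChart

/-! ### Naturality of Hamilton's blocks and the law on `4`-manifolds -/

section NaturalityAndManifold

section Naturality

variable {E : Type*} [NormedAddCommGroup E] [NormedSpace ℝ E] {H : Type*} [TopologicalSpace H]
  {I : ModelWithCorners ℝ E H} {M : Type*} [TopologicalSpace M] [ChartedSpace H M]
  [IsManifold I ∞ M]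
  {E' : Type*} [NormedAddCommGroup E'] [NormedSpace ℝ E'] {H' : Type*} [TopologicalSpace H']
  {I' : ModelWithCorners ℝ E' H'} {N : Type*} [TopologicalSpace N] [ChartedSpace H' N]
  [IsManifold I' ∞ N]
  [FiniteDimensional ℝ E] [FiniteDimensional ℝ E'] [CompleteSpace E] [CompleteSpace E']
  (g : PseudoRiemannianMetric I ∞ E (TangentSpace I : M → Type _))
  {Φ : N → M} (hpb : contMDiff_pullbackBilin I M I' N ∞) (hΦ : ContMDiff I' I (∞ + 1) Φ)
  (hΦ' : ∀ u, Function.Injective (mfderiv I' I Φ u))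
  (hdim : Module.finrank ℝ E' = Module.finrank ℝ E)

include hΦ' in
/-- Private copy of `curvatureForm_comap_leviCivita` (`AlmostNonnegativeCurvatureSmoothingProofs.lean`,
the public theorem; O'Neill 1983, Ch. 3, Prop. 3.59), kept out of this file's imports.
[cite: ONeill1983, Ch. 3, Prop. 3.59] -/
private theorem curvatureForm_comap_aux' [g.HasLeviCivita] [(g.comap hpb Φ hΦ hΦ' hdim).HasLeviCivita]
    (u : N) (p q r s : TangentSpace I' u) :
    (g.comap hpb Φ hΦ hΦ' hdim).curvatureForm (g.comap hpb Φ hΦ hΦ' hdim).leviCivita u p q r s =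
      g.curvatureForm g.leviCivita (Φ u) (mfderiv I' I Φ u p) (mfderiv I' I Φ u q)
        (mfderiv I' I Φ u r) (mfderiv I' I Φ u s) := by
  have hinv := isInvertible_mfderiv_of_injective (Φ := Φ) hdim (hΦ' u)
  unfold curvatureForm
  rw [show (g.comap hpb Φ hΦ hΦ' hdim).leviCivita.curvature u p q r =
      (g.comap hpb Φ hΦ hΦ' hdim).riemann u p q r from rfl,
    show g.leviCivita.curvature (Φ u) (mfderiv I' I Φ u p) (mfderiv I' I Φ u q) (mfderiv I' I Φ u r) =
      g.riemann (Φ u) (mfderiv I' I Φ u p) (mfderiv I' I Φ u q) (mfderiv I' I Φ u r) from rfl,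
    g.riemann_comap_apply hpb hΦ hΦ' hdim u p q r, val_comap, pullbackBilin_apply,
    hinv.self_apply_inverse]

include hΦ' in
/-- **Naturality of Hamilton's blocks**: the blocks `A`, `C` of `Φ^*g` at `u` in a `4`-frame `e`
are those of `g` at `Φ u` in the frame `dΦ_u ∘ e` (they are sums of curvature components,
`blockA_eq_blockArr`). [cite: ONeill1983, Ch. 3, Prop. 3.59] [cite: Hamilton1997, §1.2] -/
theorem _root_.Literature.Geometry.Lorentzian.PseudoRiemannianMetric.blockA_comap [g.HasLeviCivita] [(g.comap hpb Φ hΦ hΦ' hdim).HasLeviCivita]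
    (u : N) (e : Fin 4 → TangentSpace I' u) :
    (g.comap hpb Φ hΦ hΦ' hdim).blockA (g.comap hpb Φ hΦ hΦ' hdim).leviCivita u e =
      g.blockA g.leviCivita (Φ u) (fun i ↦ mfderiv I' I Φ u (e i)) := by
  ext i j
  rw [blockA_eq_blockArr, blockA_eq_blockArr]
  simp only [curvatureForm_comap_aux' g hpb hΦ hΦ' hdim]

include hΦ' in
/-- Naturality of the block `C`. [cite: ONeill1983, Ch. 3, Prop. 3.59] [cite: Hamilton1997, §1.2] -/
theorem _root_.Literature.Geometry.Lorentzian.PseudoRiemannianMetric.blockC_comap [g.HasLeviCivita] [(g.comap hpb Φ hΦ hΦ' hdim).HasLeviCivita]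
    (u : N) (e : Fin 4 → TangentSpace I' u) :
    (g.comap hpb Φ hΦ hΦ' hdim).blockC (g.comap hpb Φ hΦ hΦ' hdim).leviCivita u e =
      g.blockC g.leviCivita (Φ u) (fun i ↦ mfderiv I' I Φ u (e i)) := by
  ext i j
  rw [blockC_eq_blockArr, blockC_eq_blockArr]
  simp only [curvatureForm_comap_aux' g hpb hΦ hΦ' hdim]

end Naturality

/-- **Chiral conformal covariance on a manifold**: on a manifold modelled on a `4`-dimensional
model space `E`, for smooth metrics `g` (Riemannian), `g' = ψ² g` (`ψ` smooth, positive) with their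
Levi-Civita connections and a `g_x`-orthonormal `4`-frame `e`: the traceless parts of Hamilton's
self-dual blocks in the frames `e/ψ(x)` (orthonormal for `g'`) and `e` satisfy
`A'₀(e/ψ) = ψ(x)⁻² A₀(e)`, i.e. **`W⁺_{ψ²g} = ψ⁻² W⁺_g`** frame-wise (and `|W⁺_{ψ²g}|² = ψ⁻⁴|W⁺_g|²`);
the chart law `OpensChart.blockA_traceFree_conformal` pulled back along the inverse chart
(naturality `blockA_comap`). [cite: Besse1987, Thm. 1.159] [cite: GurskyLebrun1999, §3, proof of Theorem 1] -/
theorem blockA_traceFree_conformal_sq {E : Type*} [NormedAddCommGroup E] [NormedSpace ℝ E]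
    [FiniteDimensional ℝ E] [CompleteSpace E]
    {X : Type*} [TopologicalSpace X] [ChartedSpace E X] [IsManifold 𝓘(ℝ, E) ∞ X]
    (g g' : PseudoRiemannianMetric 𝓘(ℝ, E) ∞ E (TangentSpace 𝓘(ℝ, E) : X → Type _))
    [g.HasLeviCivita] [g'.HasLeviCivita] {ψ : X → ℝ}
    (hψ : ContMDiff 𝓘(ℝ, E) 𝓘(ℝ) ∞ ψ) (hpos : ∀ x : X, 0 < ψ x)
    (hgg' : ∀ (x : X) (v w : TangentSpace 𝓘(ℝ, E) x), g'.val x v w = ψ x ^ 2 * g.val x v w)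
    (x : X) {e : Fin 4 → TangentSpace 𝓘(ℝ, E) x} (he : g.IsOrthonormalFrame x e) :
    g'.blockA g'.leviCivita x (fun i ↦ (ψ x)⁻¹ • e i) -
        ((g'.blockA g'.leviCivita x (fun i ↦ (ψ x)⁻¹ • e i)).trace / 3) •
          (1 : Matrix (Fin 3) (Fin 3) ℝ) =
      (ψ x ^ 2)⁻¹ • (g.blockA g.leviCivita x e -
        ((g.blockA g.leviCivita x e).trace / 3) • (1 : Matrix (Fin 3) (Fin 3) ℝ)) := by
  -- the inverse chart at `x`
  set U : TopologicalSpace.Opens E := ⟨(chartAt E x).target, (chartAt E x).open_target⟩ with hU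
  set Φ : U → X := fun u ↦ (chartAt E x).symm u with hΦdef
  have hΦ : ContMDiff 𝓘(ℝ, E) 𝓘(ℝ, E) (∞ + 1) Φ := ChartInverseSelf.contMDiff_symm x
  have hΦ' : ∀ u, Function.Injective (mfderiv 𝓘(ℝ, E) 𝓘(ℝ, E) Φ u) :=
    ChartInverseSelf.injective_mfderiv_symm x
  have hdim : Module.finrank ℝ E = Module.finrank ℝ E := rfl
  have hpb : contMDiff_pullbackBilin 𝓘(ℝ, E) X 𝓘(ℝ, E) U ∞ := contMDiff_pullbackBilin_holds
  set u₀ : U := ⟨chartAt E x x, (chartAt E x).map_source (mem_chart_source E x)⟩ with hu₀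
  have hx : Φ u₀ = x := (chartAt E x).left_inv (mem_chart_source E x)
  set gU := g.comap hpb Φ hΦ hΦ' hdim with hgU
  set gU' := g'.comap hpb Φ hΦ hΦ' hdim with hgU'
  haveI : gU.HasLeviCivita := gU.hasLeviCivita
  haveI : gU'.HasLeviCivita := gU'.hasLeviCivita
  have hinv := isInvertible_mfderiv_of_injective (Φ := Φ) hdim (hΦ' u₀)
  -- representatives on `E`
  set G : E → E →L[ℝ] E →L[ℝ] ℝ := Function.extend (Subtype.val : U → E)
    (fun y : U ↦ (gU.val y : E →L[ℝ] E →L[ℝ] ℝ)) (fun _ ↦ 0) with hGdef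
  set ψE : E → ℝ := fun y ↦ ψ ((chartAt E x).symm y) with hψEdef
  have hG : ∀ y : U, gU.val y = G y := fun y ↦ by
    rw [hGdef, Subtype.val_injective.extend_apply]
  have hG' : ∀ y : U, gU'.val y = (fun y ↦ (fun z ↦ ψE z ^ 2) y • G y) y := by
    intro y
    ext v w
    change g'.val (Φ y) (mfderiv 𝓘(ℝ, E) 𝓘(ℝ, E) Φ y v) (mfderiv 𝓘(ℝ, E) 𝓘(ℝ, E) Φ y w) =
      ψE y ^ 2 * G y v w
    rw [hgg', ← hG y]
    rfl
  have hψs : ContDiffOn ℝ ∞ (fun y ↦ ψE y ^ 2) (U : Set E) := fun y hy ↦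
    ((ChartInverseSelf.contDiffAt_comp_symm x hψ hy).pow 2).contDiffWithinAt
  have hψ0 : ∀ y ∈ (U : Set E), ψE y ^ 2 ≠ 0 := fun y _ ↦ pow_ne_zero 2 (hpos _).ne'
  -- the frame `e` pulled back to `u₀`
  set eU : Fin 4 → TangentSpace 𝓘(ℝ, E) u₀ := fun i ↦ (mfderiv 𝓘(ℝ, E) 𝓘(ℝ, E) Φ u₀).inverse (e i)
    with heU
  have hde : ∀ i, mfderiv 𝓘(ℝ, E) 𝓘(ℝ, E) Φ u₀ (eU i) = e i := fun i ↦ hinv.self_apply_inverse (e i)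
  have hψu : ψE u₀ = ψ x := by
    show ψ (Φ u₀) = ψ x
    rw [hx]
  have hval : ∀ v w : E, gU.val u₀ v w =
      g.val x (mfderiv 𝓘(ℝ, E) 𝓘(ℝ, E) Φ u₀ v) (mfderiv 𝓘(ℝ, E) 𝓘(ℝ, E) Φ u₀ w) := by
    intro v w
    have h0 : gU.val u₀ v w =
        g.val (Φ u₀) (mfderiv 𝓘(ℝ, E) 𝓘(ℝ, E) Φ u₀ v) (mfderiv 𝓘(ℝ, E) 𝓘(ℝ, E) Φ u₀ w) := rfl
    rw [h0, hx]
  have heU_on : gU.IsOrthonormalFrame u₀ eU := by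
    refine ⟨fun i ↦ ?_, fun i j hij ↦ ?_⟩
    · rw [hval, hde]; exact he.1 i
    · rw [hval, hde, hde]; exact he.2 i j hij
  have ha : ψE u₀ ≠ 0 := (hpos _).ne'
  have hax : (fun z ↦ ψE z ^ 2) (u₀ : E) = ψE u₀ ^ 2 := rfl
  -- transport of frames along `Φ u₀ = x`
  have key : ∀ (h : PseudoRiemannianMetric 𝓘(ℝ, E) ∞ E (TangentSpace 𝓘(ℝ, E) : X → Type _))
      [h.HasLeviCivita] (y : X), y = x → ∀ (f f₀ : Fin 4 → E), (∀ i, f i = f₀ i) →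
      h.blockA h.leviCivita y f = h.blockA h.leviCivita x f₀ := by
    rintro h _ _ rfl f f₀ hf
    rw [show f = f₀ from funext hf]
  have hA : gU.blockA gU.leviCivita u₀ eU = g.blockA g.leviCivita x e :=
    (g.blockA_comap hpb hΦ hΦ' hdim u₀ eU).trans (key g _ hx _ _ hde)
  have hA' : gU'.blockA gU'.leviCivita u₀ (fun i ↦ (ψE u₀)⁻¹ • eU i) =
      g'.blockA g'.leviCivita x (fun i ↦ (ψ x)⁻¹ • e i) := by
    refine (g'.blockA_comap hpb hΦ hΦ' hdim u₀ _).trans (key g' _ hx _ _ fun i ↦ ?_)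
    rw [map_smul, hde, hψu]
    rfl
  rw [← hA, ← hA', ← hψu]
  exact OpensChart.blockA_traceFree_conformal (c := fun z ↦ ψE z ^ 2) hG hG' hψs hψ0 u₀ ha hax heU_on

end NaturalityAndManifold


variable {M : Type*} [TopologicalSpace M] [ChartedSpace (EuclideanSpace ℝ (Fin 4)) M]
  [IsManifold (𝓡 4) ∞ M]

omit [IsManifold (𝓡 4) ∞ M] in
/-- **Rescaling a frame by `c` multiplies its determinant by `c⁴`.** [folklore] -/
theorem det_frameOfFin_smul {x : M} (e : Fin 4 → TangentSpace (𝓡 4) x) (c : ℝ) :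
    (finBasis ℝ (EuclideanSpace ℝ (Fin 4))).det (frameOfFin (fun i ↦ c • e i)) =
      c ^ 4 * (finBasis ℝ (EuclideanSpace ℝ (Fin 4))).det (frameOfFin e) := by
  have h := (finBasis ℝ (EuclideanSpace ℝ (Fin 4))).det.toMultilinearMap.map_smul_univ
    (fun _ ↦ c) (frameOfFin e)
  simp only [AlternatingMap.coe_multilinearMap, Finset.prod_const, Finset.card_univ, Fintype.card_fin,
    finrank_euclideanSpace_fin, smul_eq_mul] at h
  exact h

/-- **Positive frames stay positive under positive rescaling.** [folklore] -/
theorem isPosFrame_smul_iff (o : SmoothOrientation (𝓡 4) M) (x : M) (e : Fin 4 → TangentSpace (𝓡 4) x)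
    {c : ℝ} (hc : 0 < c) :
    o.IsPosFrame x (frameOfFin (fun i ↦ c • e i)) ↔ o.IsPosFrame x (frameOfFin e) := by
  rw [SmoothOrientation.IsPosFrame, SmoothOrientation.IsPosFrame, det_frameOfFin_smul, ← mul_assoc,
    mul_comm (o.sign x) (c ^ 4), mul_assoc]
  exact mul_pos_iff_of_pos_left (pow_pos hc 4)

/-- **The chiral Weyl energy `∫|W⁺|² dμ` is conformally invariant in dimension four**, in the
frame-wise vocabulary of `gursky_einstein_homotopySphere_four_of_oriented`
(`GurskyEinsteinGapProofs.lean`): on a compact oriented `4`-manifold, for smooth metrics `g`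
(Riemannian), `g' = ψ²g` with their Levi-Civita connections, if `w₊` is a version of `|W⁺_g|²`
(at every point `w₊ = ¼‖A − (tr A/3)1‖²_F` in some positively oriented `g`-orthonormal frame), then
`ψ⁻⁴ w₊` is a version of `|W⁺_{g'}|²` (in the rescaled frames `e/ψ`: `blockA_traceFree_conformal_sq`,
`isPosFrame_smul_iff`) and `∫ ψ⁻⁴ w₊ dμ_{g'} = ∫ w₊ dμ_g` (`dμ_{g'} = ψ⁴ dμ_g`,
`riemannianMeasure_eq_withDensity_of_conformal_sq_four`) — "the `L²` norm of `W⁺` is conformally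
invariant" (Gursky–LeBrun 1999, §3, proof of Theorem 1). [cite: GurskyLebrun1999, §3, proof of Theorem 1]
[cite: Besse1987, Thm. 1.159] -/
theorem chiralWeylEnergy_conformal_sq_four [T2Space M] [T3Space M] [CompactSpace M]
    [MeasurableSpace M] [BorelSpace M]
    (g g' : PseudoRiemannianMetric (𝓡 4) ∞ (EuclideanSpace ℝ (Fin 4)) (TangentSpace (𝓡 4) : M → Type _))
    [g.HasLeviCivita] [g'.HasLeviCivita] (hg : g.IsRiemannian) {ψ : M → ℝ}
    (hψ : ContMDiff (𝓡 4) 𝓘(ℝ) ∞ ψ) (hpos : ∀ x : M, 0 < ψ x)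
    (hgg' : ∀ (x : M) (v w : TangentSpace (𝓡 4) x), g'.val x v w = ψ x ^ 2 * g.val x v w)
    (o : SmoothOrientation (𝓡 4) M) {wp : M → ℝ}
    (hwp : ∀ x, ∃ e : Fin 4 → TangentSpace (𝓡 4) x, g.IsOrthonormalFrame x e ∧
      o.IsPosFrame x (frameOfFin e) ∧
      wp x = (1 / 4 : ℝ) * ∑ i : Fin 3, ∑ j : Fin 3,
        ((g.blockA g.leviCivita x e -
          ((g.blockA g.leviCivita x e).trace / 3) • (1 : Matrix (Fin 3) (Fin 3) ℝ)) i j) ^ 2) :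
    (∀ x, ∃ e : Fin 4 → TangentSpace (𝓡 4) x, g'.IsOrthonormalFrame x e ∧
      o.IsPosFrame x (frameOfFin e) ∧
      (ψ x ^ 4)⁻¹ * wp x = (1 / 4 : ℝ) * ∑ i : Fin 3, ∑ j : Fin 3,
        ((g'.blockA g'.leviCivita x e -
          ((g'.blockA g'.leviCivita x e).trace / 3) • (1 : Matrix (Fin 3) (Fin 3) ℝ)) i j) ^ 2) ∧
    ∫⁻ x, ENNReal.ofReal ((ψ x ^ 4)⁻¹ * wp x)
        ∂riemannianMeasure (g'.toContMDiffRiemannianMetric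
          (fun y v hv ↦ by rw [hgg']; exact mul_pos (pow_pos (hpos y) 2) (hg y v hv))) =
      ∫⁻ x, ENNReal.ofReal (wp x) ∂riemannianMeasure (g.toContMDiffRiemannianMetric hg) := by
  have hg' : g'.IsRiemannian := fun y v hv ↦ by
    rw [hgg']
    exact mul_pos (pow_pos (hpos y) 2) (hg y v hv)
  refine ⟨fun x ↦ ?_, ?_⟩
  · obtain ⟨e, he, hpos_e, hw⟩ := hwp x
    refine ⟨fun i ↦ (ψ x)⁻¹ • e i, ⟨fun i ↦ ?_, fun i j hij ↦ ?_⟩,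
      (isPosFrame_smul_iff o x e (inv_pos.2 (hpos x))).2 hpos_e, ?_⟩
    · show g'.val x ((ψ x)⁻¹ • e i) ((ψ x)⁻¹ • e i) = 1
      rw [hgg']
      simp only [map_smul, _root_.smul_apply, smul_eq_mul, he.1 i]
      have hψ0 : ψ x ≠ 0 := (hpos x).ne'
      field_simp
    · show g'.val x ((ψ x)⁻¹ • e i) ((ψ x)⁻¹ • e j) = 0
      rw [hgg']
      simp only [map_smul, _root_.smul_apply, smul_eq_mul, he.2 i j hij, mul_zero]
    · rw [blockA_traceFree_conformal_sq g g' hψ hpos hgg' x he, hw]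
      simp only [Matrix.smul_apply, smul_eq_mul, mul_pow, ← Finset.mul_sum]
      have hψ0 : ψ x ≠ 0 := (hpos x).ne'
      field_simp
  · have hψm : Measurable ψ := hψ.continuous.measurable
    have hmeas : Measurable (fun p : M ↦ ENNReal.ofReal (ψ p ^ 4)) :=
      ENNReal.measurable_ofReal.comp (hψm.pow_const 4)
    rw [riemannianMeasure_eq_withDensity_of_conformal_sq_four (g'.toContMDiffRiemannianMetric hg')
        (g.toContMDiffRiemannianMetric hg) hψm (fun p v w ↦ hgg' p v w),
      lintegral_withDensity_eq_lintegral_mul_non_measurable _ hmeas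
        (Filter.Eventually.of_forall fun _ ↦ ENNReal.ofReal_lt_top)]
    refine lintegral_congr fun x ↦ ?_
    have hw0 : 0 ≤ wp x := by
      obtain ⟨e, -, -, hw⟩ := hwp x
      rw [hw]
      exact mul_nonneg (by norm_num) (Finset.sum_nonneg fun _ _ ↦ Finset.sum_nonneg fun _ _ ↦ sq_nonneg _)
    rw [Pi.mul_apply, ← ENNReal.ofReal_mul (pow_nonneg (hpos x).le 4)]
    congr 1
    have hψ4 : ψ x ^ 4 ≠ 0 := pow_ne_zero 4 (hpos x).ne'
    rw [← mul_assoc, mul_inv_cancel₀ hψ4, one_mul]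


end Literature.Geometry.Riemannian

end
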